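import Summits.BirchSwinnertonDyer.BirchSwinnertonDyer.Theorems.EisensteinPrimesAnalyticLambdaAbsoluteCount
import HarnessLib

/-!
# Route `EisensteinPrimes`, line `mudescent`, cruxes 3/5: the ABSOLUTE analytic `(μ, λ)`-count from a
# congruence with a NON-UNIT series of unit content times split-prime raising factors — the socket of
# THEOREM B″ (Mazur's «secondary anomalous» control classes; helper; THEOREMS ONLY)

Seat `bsd-eis-lam-a` g10 (PROGRAMME PART 1b, ACCEL-LIST (4): ANALYTIC side of
`stub_lambdaCount_offLocus`; items stmt-BirchSwinnertonDyer-19033 / -19035; skeleton owner bsd-eis-ky,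
`Lines/mudescent.lean`). No definition, no named fact, nothing about any particular curve; closes
nothing; moves no label.

WHAT AND WHY (HOME/lam-a-g10/lam-a-MEMO-10.md, THEOREMS B′/B″). MEMO-10 re-sources the prime-level input
of MEMO-9's THEOREM B from Pollack–Wake 2025 to Mazur, Publ. Math. IHÉS 47 (1977) III Cor. (8.5): at an
Eisenstein prime `𝔓 ∣ p` (any ODD `p`) of `J₀(q)`, the cuspidal-normalised `𝔓`-adic `L`-series
`𝓛_q := η⁻¹·L_𝔓(χ₀, T) ∈ T_𝔓⟦T⟧` has constant term `δ²` and «is a unit in `T_𝔓⟦T⟧` if and only if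
`p` is not a `p`-th power modulo `q`». When `p` IS a `p`-th power modulo `q` (Mazur's Remark: «a
"secondary" analogue to the phenomenon of anomalous primes … either divisible by more than `η`, or at
least one zero in the open unit disc»), the twin transfer of MEMO-9 §3 survives verbatim (THEOREM B″):
`G_{E_ét} ≡ u·𝓛_q·∏_{ℓ split}(1 − γ_ℓ)·∏_{ℓ non-split}(1 + γ_ℓ) (mod pΛ)` with `𝓛_q` now NOT a unit,
and — provided `μ(𝓛_q) = 0` — `λ_an(E_ét) = Σ_{ℓ split} s_ℓ + e_q` with `e_q := λ(𝓛̄_q) ≥ 1` a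
constant of the prime `q` (the cell's empirical law «excess constant per Kummer class», g5/g6; of
record e_q ∈ {2, 4, 6, 10} at p = 3, N < 3·10⁴, 93/93 members). This file proves everything DOWNSTREAM
of that congruence, i.e. the predecessor file's §1/§3/§4 with the UNIT `U` replaced by a series `U` of
UNIT CONTENT and `λ(U) = e`:

* §1 (`Λ`-algebra): `hasUnitContent_and_lam_eq_add_of_truncCongr_mul` — `G ≡ u·U·Q (mod p, T^K)`,
  `U` of unit content with `λ(U) = e`, `Q` of unit content with `ord_T(Q̄) = d`, `e + d < K` ⟹ `G`
  has unit content and `λ(G) = e + d`; the same fed by VALUES (`…_of_valueCongr_mul`).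
* §2 (X2 currency, crux 3): `X2.analyticMuLE_zero_and_analyticLambdaEq_add_of_truncCongr`,
  `…_add_of_valueCongr`, and THEOREM B″'s instance
  `X2.analyticMuLE_zero_and_analyticLambdaEq_add_sum_sFactor_of_valueCongr`:
  `X2.AnalyticMuLE W p 0 ∧ X2.AnalyticLambdaEq W p (e + Σ_{ℓ∈S} s_ℓ)`.
* §3 (X1 currency, crux 5 / good ordinary rows): the same two statements.

HONEST FRAMING. The congruence hypothesis is what MEMO-10 THEOREM B″ PROVES ON PAPER (modulo Mazur
1977 II (16.6)/(18.10), III (8.1)/(8.5), Ribet 1990 Prop. 1, Vatsal 2005 Thm. 1.1, Ohta 2014 (3.6.2) /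
Yoo 2023 Thm. 1.4); `e = λ(𝓛̄_q)` is NOT given by a formula — one reading per prime `q` fixes it for
every conductor. Nothing here asserts the congruence or the value of `e`.

References: [Mazur1977] III Prop. (8.1), Cor. (8.4), Cor. (8.5) and Remark (p. 166); II Prop. (16.6),
Thm. (18.10); [GreenbergVatsal2000] §1 (8)–(10), §2 Prop. (2.4); [Washington1997] §7.1–7.2;
HOME/lam-a-g10/lam-a-MEMO-10.md §3–§4.
-/

set_option linter.dupNamespace false
set_option autoImplicit false

noncomputable section

open scoped Classical MatrixGroups ModularForm

open PowerSeries CongruenceSubgroup WeierstrassCurve NumberField IsDedekindDomain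
  Literature.NumberTheory.EllipticCurves
  Literature.NumberTheory.EllipticCurves.ModularForms
  Literature.NumberTheory.EllipticCurves.Rank1Residual
  Literature.NumberTheory.EllipticCurves.GreenbergVatsal2000
  Summit.BirchSwinnertonDyer.Rank1Residual
  Summit.BirchSwinnertonDyer.Rank1Residual.X1.MuLambda
  Summit.BirchSwinnertonDyer.Rank1Residual.X11a
  Summit.BirchSwinnertonDyer.Rank1Residual.Iwasawa
  Summit.BirchSwinnertonDyer.Rank1Residual.X2.EulerFactorAlgebra
  Summit.BirchSwinnertonDyer.Rank1Residual.X2.EulerFactorInvariants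
  Summit.BirchSwinnertonDyer.Rank1Residual.X2.GreenbergVatsalAnalyticTransferCore
  Summit.BirchSwinnertonDyer.BirchSwinnertonDyer.Theorems
  Summit.BirchSwinnertonDyer.BirchSwinnertonDyer.Theorems.EisensteinPrimesAnalyticLambdaCongruenceTransfer
  Summit.BirchSwinnertonDyer.BirchSwinnertonDyer.Theorems.EisensteinPrimesAnalyticLambdaValueCongruence
  Summit.BirchSwinnertonDyer.BirchSwinnertonDyer.Theorems.EisensteinPrimesX2AnalyticLambdaResultantCertificate
  Summit.BirchSwinnertonDyer.BirchSwinnertonDyer.Theorems.EisensteinPrimesAnalyticLambdaAbsoluteCount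

namespace Summit.BirchSwinnertonDyer.BirchSwinnertonDyer.Theorems.EisensteinPrimesAnalyticLambdaNonUnitCount

variable {p : ℕ} [hp : Fact p.Prime]

/-! ## §1. `Λ`-algebra: congruence with (unit-content series of `λ = e`) × (multiplier of order `d`) -/

section Algebra

/-- **Congruence with a unit-content series times a multiplier ⟹ `μ = 0` and `λ = e + d`.** If
`[T^j]Ḡ = u·[T^j](U·Q)‾` in `𝔽_p` for all `j < K`, with `u ≠ 0`, `U` of unit content with `λ(U) = e`,
`Q` of unit content with `ord_T Q̄ = d` and `e + d < K`, then `G` has unit content (`μ(G) = 0`) and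
`λ(G) = e + d` — the shape in which THEOREM B″ delivers the absolute count on Mazur's control classes
(`U = 𝓛_q`, `e = e_q`, `Q` = the raising factors). [cite: Mazur1977, III Cor. (8.5) and Remark]
[cite: GreenbergVatsal2000, §1 (9)–(10)] [cite: Washington1997, §7.1] -/
theorem hasUnitContent_and_lam_eq_add_of_truncCongr_mul {G U Q : IwasawaAlgebra p}
    (hU : HasUnitContent U) {e : ℕ} (he : lam U = e) (hQ : HasUnitContent Q) {d : ℕ}
    (hd : (PowerSeries.map (PadicInt.toZMod (p := p)) Q).order = d) {u : ZMod p} (hu : u ≠ 0) {K : ℕ}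
    (hcong : ∀ j < K, PowerSeries.coeff j (PowerSeries.map (PadicInt.toZMod (p := p)) G) =
      u * PowerSeries.coeff j (PowerSeries.map (PadicInt.toZMod (p := p)) (U * Q)))
    (hK : e + d < K) : HasUnitContent G ∧ lam G = e + d := by
  have hcong' : ∀ j < K, PowerSeries.coeff j (PowerSeries.map (PadicInt.toZMod (p := p)) (G * 1)) =
      u * PowerSeries.coeff j (PowerSeries.map (PadicInt.toZMod (p := p)) (U * Q)) := by
    intro j hj; rw [mul_one]; exact hcong j hj
  have hK' : lam U + d < K := by rw [he]; exact hK
  obtain ⟨hG, h⟩ := EisensteinPrimesAnalyticLambdaCongruenceTransfer.hasUnitContent_and_lam_add_eq_of_truncCongr_mul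
    EisensteinPrimesAnalyticLambdaAbsoluteCount.order_map_toZMod_one hQ hd hu hcong' hU hK'
  rw [he, add_zero] at h
  exact ⟨hG, h⟩

/-- **The same fed by VALUES at the `p`-power roots of unity** (`G(ζ − 1) ≡ c·(U·Q)(ζ − 1) (mod p)`
for all primitive `p^{m+1}`-th roots `ζ`, `m ≥ n₀`, one unit `c ∈ ℤ_p`): then `μ(G) = 0` and
`λ(G) = e + ord_T Q̄`. [cite: Washington1997, §7.1–7.2, Thm. 7.3] -/
theorem hasUnitContent_and_lam_eq_add_of_valueCongr_mul {G U Q : IwasawaAlgebra p}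
    (hU : HasUnitContent U) {e : ℕ} (he : lam U = e) (hQ : HasUnitContent Q) {d : ℕ}
    (hd : (PowerSeries.map (PadicInt.toZMod (p := p)) Q).order = d) {c : ℤ_[p]} (hc : IsUnit c)
    {n₀ : ℕ}
    (hval : ∀ m : ℕ, n₀ ≤ m → ∀ ζ : ℂ_[p], IsPrimitiveRoot ζ (p ^ (m + 1)) →
      ‖∑' k, ((algebraMap ℚ_[p] ℂ_[p]).comp (algebraMap ℤ_[p] ℚ_[p]))
          (PowerSeries.coeff k (G - PowerSeries.C c * (U * Q))) * (ζ - 1) ^ k‖ ≤ (p : ℝ)⁻¹) :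
    HasUnitContent G ∧ lam G = e + d :=
  hasUnitContent_and_lam_eq_add_of_truncCongr_mul hU he hQ hd
    (EisensteinPrimesAnalyticLambdaValueCongruence.toZMod_ne_zero_of_isUnit hc) (K := e + d + 1)
    (fun j _ ↦ EisensteinPrimesAnalyticLambdaValueCongruence.forall_coeff_toZMod_eq_of_forall_norm_tsum_le
      hval j) (Nat.lt_succ_self _)

end Algebra

/-! ## §2. X2 currency (crux 3, multiplicative rows): THEOREM B″'s socket -/

section X2

variable {W : WeierstrassCurve ℚ} [W.IsElliptic] [W.IsGloballyMinimal]
  {N : ℕ} [NeZero N] {f : CuspForm (Gamma0 N) 2} {ϖ : ℚ} {L : PowerSeries ℚ_[p]}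

/-- **X2: `μ_an(W) = 0` and `λ_an(W) = e + d` from ONE truncated congruence with a unit-content series
of `λ = e` times a multiplier of order `d`.** Data: `(f, ϖ, L)` the datum of `X2.AnalyticMuLE` /
`X2.AnalyticLambdaEq` at `(W, p)` (odd multiplicative `p`) with an integral model `ι(G) = ϖ·L`; `U` of
unit content with `λ(U) = e` (intended: Mazur's `𝓛_q = η⁻¹L_𝔓(χ₀,T)` at a prime `q` with `p` a `p`-th
power mod `q`, constant term `δ² ∈ pℤ_p`, `e = e_q ≥ 1`); `Q` of unit content and reduced `T`-order `d`;
the DISPLAYED hypothesis `[T^j]Ḡ = u·[T^j](U·Q)‾` for `j < K`, `u ≠ 0`, `e + d < K`. Conclusion: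
`X2.AnalyticMuLE W p 0 ∧ X2.AnalyticLambdaEq W p (e + d)` (trivial zero included).
[cite: Mazur1977, III Cor. (8.5) and Remark] [cite: GreenbergVatsal2000, §1 (9)–(10)] [cite: Washington1997, §7.1] -/
theorem X2.analyticMuLE_zero_and_analyticLambdaEq_add_of_truncCongr (hf : IsNewformOf W f)
    (hϖ : (ϖ : ℝ) * W.realPeriodRat = plusPeriod f)
    (hLs : W.HasSplitMultiplicativeReductionAtPrime p → IsSplitMultPAdicLFunctionOf f p L)
    (hLn : ¬ W.HasSplitMultiplicativeReductionAtPrime p → IsMultPAdicLFunctionOf f p (-1) L)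
    {G : IwasawaAlgebra p} (hG : iwasawaToPowerSeries p G = PowerSeries.C ((ϖ : ℚ) : ℚ_[p]) * L)
    {U Q : IwasawaAlgebra p} (hU : HasUnitContent U) {e : ℕ} (he : lam U = e) (hQ : HasUnitContent Q)
    {d : ℕ} (hd : (PowerSeries.map (PadicInt.toZMod (p := p)) Q).order = d) {u : ZMod p} (hu : u ≠ 0)
    {K : ℕ}
    (hcong : ∀ j < K, PowerSeries.coeff j (PowerSeries.map (PadicInt.toZMod (p := p)) G) =
      u * PowerSeries.coeff j (PowerSeries.map (PadicInt.toZMod (p := p)) (U * Q)))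
    (hK : e + d < K) : X2.AnalyticMuLE W p 0 ∧ X2.AnalyticLambdaEq W p (e + d) := by
  obtain ⟨hGu, hlamG⟩ := hasUnitContent_and_lam_eq_add_of_truncCongr_mul hU he hQ hd hu hcong hK
  obtain ⟨k, hk⟩ := (hasUnitContent_iff_exists_norm_eq_one G).mp hGu
  rw [EisensteinPrimesX2AnalyticLambdaCertificate.norm_coeff_eq_of_iota_eq hG] at hk
  refine ⟨EisensteinPrimesX2AnalyticLambdaCertificate.analyticMuLE_zero_of_norm_coeff_eq_one hf hϖ
      hLs hLn hk,
    (EisensteinPrimesX2AnalyticLambdaCertificate.analyticLambdaEq_iff_of_datum hf hϖ hLs hLn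
      (e + d)).mpr fun G₁ hG₁ ↦ ?_⟩
  rw [iwasawaToPowerSeries_injective p (hG₁.trans hG.symm), hlamG]

/-- **X2, fed by VALUES** (THEOREM B″'s output currency: one unit `c ∈ ℤ_p` and
`‖(G − C(c)·U·Q)(ζ − 1)‖ ≤ 1/p` at every primitive `p^{m+1}`-th root of unity, `m ≥ n₀`).
Conclusion: `X2.AnalyticMuLE W p 0 ∧ X2.AnalyticLambdaEq W p (e + d)`.
[cite: Mazur1977, III Cor. (8.5) and Remark] [cite: Washington1997, §7.1–7.2, Thm. 7.3] -/
theorem X2.analyticMuLE_zero_and_analyticLambdaEq_add_of_valueCongr (hf : IsNewformOf W f)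
    (hϖ : (ϖ : ℝ) * W.realPeriodRat = plusPeriod f)
    (hLs : W.HasSplitMultiplicativeReductionAtPrime p → IsSplitMultPAdicLFunctionOf f p L)
    (hLn : ¬ W.HasSplitMultiplicativeReductionAtPrime p → IsMultPAdicLFunctionOf f p (-1) L)
    {G : IwasawaAlgebra p} (hG : iwasawaToPowerSeries p G = PowerSeries.C ((ϖ : ℚ) : ℚ_[p]) * L)
    {U Q : IwasawaAlgebra p} (hU : HasUnitContent U) {e : ℕ} (he : lam U = e) (hQ : HasUnitContent Q)
    {d : ℕ} (hd : (PowerSeries.map (PadicInt.toZMod (p := p)) Q).order = d) {c : ℤ_[p]}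
    (hc : IsUnit c) {n₀ : ℕ}
    (hval : ∀ m : ℕ, n₀ ≤ m → ∀ ζ : ℂ_[p], IsPrimitiveRoot ζ (p ^ (m + 1)) →
      ‖∑' k, ((algebraMap ℚ_[p] ℂ_[p]).comp (algebraMap ℤ_[p] ℚ_[p]))
          (PowerSeries.coeff k (G - PowerSeries.C c * (U * Q))) * (ζ - 1) ^ k‖ ≤ (p : ℝ)⁻¹) :
    X2.AnalyticMuLE W p 0 ∧ X2.AnalyticLambdaEq W p (e + d) :=
  X2.analyticMuLE_zero_and_analyticLambdaEq_add_of_truncCongr hf hϖ hLs hLn hG hU he hQ hd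
    (EisensteinPrimesAnalyticLambdaValueCongruence.toZMod_ne_zero_of_isUnit hc) (K := e + d + 1)
    (fun j _ ↦ EisensteinPrimesAnalyticLambdaValueCongruence.forall_coeff_toZMod_eq_of_forall_norm_tsum_le
      hval j) (Nat.lt_succ_self _)

/-- **THEOREM B″'s instance (X2 currency): `μ_an(W) = 0` and `λ_an(W) = e + Σ_{ℓ∈S} s_ℓ`.** With
the multiplier `Q = ∏_{ℓ∈S}(1 − γ_ℓ)` over a finite set `S` of integers `> 1` prime to the odd prime `p`
(intended: the SPLIT multiplicative primes `ℓ ∉ {p, q}` of `W`; the non-split factors `1 + γ_ℓ` are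
units and are absorbed in `U`, whose content and `λ` they do not change), a series `U` of unit content
with `λ(U) = e` (Mazur's non-unit `𝓛_q`, `e = e_q`) and the value congruence at all primitive `p`-power
roots of unity of level `> n₀`: `X2.AnalyticMuLE W p 0 ∧ X2.AnalyticLambdaEq W p (e + Σ_{ℓ∈S} s_ℓ)` —
the ABSOLUTE count on Mazur's control classes predicted by THEOREM B″ (trivial zero at a split `p`
INCLUDED; MEMO-10 §4: predictions registered for 15 census cells of record before the kit job was read).
[cite: Mazur1977, III Cor. (8.5) and Remark] [cite: GreenbergVatsal2000, §1 (9), §2 Prop. (2.4)] -/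
theorem X2.analyticMuLE_zero_and_analyticLambdaEq_add_sum_sFactor_of_valueCongr (hp2 : p ≠ 2)
    (hf : IsNewformOf W f) (hϖ : (ϖ : ℝ) * W.realPeriodRat = plusPeriod f)
    (hLs : W.HasSplitMultiplicativeReductionAtPrime p → IsSplitMultPAdicLFunctionOf f p L)
    (hLn : ¬ W.HasSplitMultiplicativeReductionAtPrime p → IsMultPAdicLFunctionOf f p (-1) L)
    {G : IwasawaAlgebra p} (hG : iwasawaToPowerSeries p G = PowerSeries.C ((ϖ : ℚ) : ℚ_[p]) * L)
    {U : IwasawaAlgebra p} (hU : HasUnitContent U) {e : ℕ} (he : lam U = e) (S : Finset ℕ)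
    (hS : ∀ ℓ ∈ S, p.Coprime ℓ ∧ 1 < ℓ) {c : ℤ_[p]} (hc : IsUnit c) {n₀ : ℕ}
    (hval : ∀ m : ℕ, n₀ ≤ m → ∀ ζ : ℂ_[p], IsPrimitiveRoot ζ (p ^ (m + 1)) →
      ‖∑' k, ((algebraMap ℚ_[p] ℂ_[p]).comp (algebraMap ℤ_[p] ℚ_[p]))
          (PowerSeries.coeff k (G - PowerSeries.C c * (U * ∏ ℓ ∈ S, (1 - frobeniusSeries p ℓ)))) *
            (ζ - 1) ^ k‖ ≤ (p : ℝ)⁻¹) :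
    X2.AnalyticMuLE W p 0 ∧ X2.AnalyticLambdaEq W p (e + ∑ ℓ ∈ S, sFactor p ℓ) := by
  obtain ⟨hQ, hd⟩ :=
    EisensteinPrimesAnalyticLambdaAbsoluteCount.hasUnitContent_and_order_prod_one_sub_frobeniusSeries hp2 S hS
  exact X2.analyticMuLE_zero_and_analyticLambdaEq_add_of_valueCongr hf hϖ hLs hLn hG hU he hQ hd hc hval

end X2

/-! ## §3. X1 currency (crux 5 / rows A1–A3, good ordinary): the same -/

section X1

variable {W : WeierstrassCurve ℚ} [W.IsElliptic] [W.IsGloballyMinimal] [NeZero (W.conductorNorm ℤ)]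
  {f : CuspForm (Gamma0 (W.conductorNorm ℤ)) 2} {ϖ : ℚ}

/-- **X1: `X1.MuPart.AnalyticMuLE W p 0 ∧ X1.ParitySqueeze.AnalyticLambdaEq W p (e + d)` from ONE
truncated congruence with a unit-content series of `λ = e` times a multiplier of order `d`** (good
ordinary target; `ι(G) = ϖ·L_p(f, α)`, `α` the unit root). [cite: Mazur1977, III Cor. (8.5) and Remark]
[cite: GreenbergVatsal2000, §1 (9)–(10)] [cite: Washington1997, §7.1] -/
theorem X1.analyticMuLE_zero_and_analyticLambdaEq_add_of_truncCongr (hf : IsNewformOf W f)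
    (hϖ : (ϖ : ℝ) * W.realPeriodRat = plusPeriod f) {G : IwasawaAlgebra p}
    (hG : iwasawaToPowerSeries p G =
      PowerSeries.C (ϖ : ℚ_[p]) * padicLFunction f (unitRoot W p : ℚ_[p]))
    {U Q : IwasawaAlgebra p} (hU : HasUnitContent U) {e : ℕ} (he : lam U = e) (hQ : HasUnitContent Q)
    {d : ℕ} (hd : (PowerSeries.map (PadicInt.toZMod (p := p)) Q).order = d) {u : ZMod p} (hu : u ≠ 0)
    {K : ℕ}
    (hcong : ∀ j < K, PowerSeries.coeff j (PowerSeries.map (PadicInt.toZMod (p := p)) G) =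
      u * PowerSeries.coeff j (PowerSeries.map (PadicInt.toZMod (p := p)) (U * Q)))
    (hK : e + d < K) :
    X1.MuPart.AnalyticMuLE W p 0 ∧ X1.ParitySqueeze.AnalyticLambdaEq W p (e + d) := by
  obtain ⟨hGu, hlamG⟩ := hasUnitContent_and_lam_eq_add_of_truncCongr_mul hU he hQ hd hu hcong hK
  obtain ⟨k, hk⟩ := (hasUnitContent_iff_exists_norm_eq_one G).mp hGu
  rw [EisensteinPrimesX2AnalyticLambdaCertificate.norm_coeff_eq_of_iota_eq hG] at hk
  refine ⟨EisensteinPrimesX1AnalyticLambdaCertificate.analyticMuLE_zero_of_norm_coeff_eq_one hf hϖ hk,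
    (EisensteinPrimesX1AnalyticLambdaCertificate.analyticLambdaEq_iff_of_datum hf hϖ (e + d)).mpr
      fun G₁ hG₁ ↦ ?_⟩
  rw [iwasawaToPowerSeries_injective p (hG₁.trans hG.symm), hlamG]

/-- **X1, THEOREM B″'s instance fed by VALUES: `μ_an(W) = 0` and `λ_an(W) = e + Σ_{ℓ∈S} s_ℓ`** at a
good ordinary target, from a unit-content `U` with `λ(U) = e` (Mazur's non-unit `𝓛_q`), the
multiplier `∏_{ℓ∈S}(1 − γ_ℓ)` (`S` = the split multiplicative primes `≠ q` of `W`, all `> 1` and prime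
to the odd `p`), and the value congruence at all primitive `p`-power roots of unity of level `> n₀`.
[cite: Mazur1977, III Cor. (8.5) and Remark] [cite: GreenbergVatsal2000, §1 (9), §2 Prop. (2.4)]
[cite: Washington1997, §7.1–7.2, Thm. 7.3] -/
theorem X1.analyticMuLE_zero_and_analyticLambdaEq_add_sum_sFactor_of_valueCongr (hp2 : p ≠ 2)
    (hf : IsNewformOf W f) (hϖ : (ϖ : ℝ) * W.realPeriodRat = plusPeriod f) {G : IwasawaAlgebra p}
    (hG : iwasawaToPowerSeries p G =
      PowerSeries.C (ϖ : ℚ_[p]) * padicLFunction f (unitRoot W p : ℚ_[p]))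
    {U : IwasawaAlgebra p} (hU : HasUnitContent U) {e : ℕ} (he : lam U = e) (S : Finset ℕ)
    (hS : ∀ ℓ ∈ S, p.Coprime ℓ ∧ 1 < ℓ) {c : ℤ_[p]} (hc : IsUnit c) {n₀ : ℕ}
    (hval : ∀ m : ℕ, n₀ ≤ m → ∀ ζ : ℂ_[p], IsPrimitiveRoot ζ (p ^ (m + 1)) →
      ‖∑' k, ((algebraMap ℚ_[p] ℂ_[p]).comp (algebraMap ℤ_[p] ℚ_[p]))
          (PowerSeries.coeff k (G - PowerSeries.C c * (U * ∏ ℓ ∈ S, (1 - frobeniusSeries p ℓ)))) *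
            (ζ - 1) ^ k‖ ≤ (p : ℝ)⁻¹) :
    X1.MuPart.AnalyticMuLE W p 0 ∧
      X1.ParitySqueeze.AnalyticLambdaEq W p (e + ∑ ℓ ∈ S, sFactor p ℓ) := by
  obtain ⟨hQ, hd⟩ :=
    EisensteinPrimesAnalyticLambdaAbsoluteCount.hasUnitContent_and_order_prod_one_sub_frobeniusSeries hp2 S hS
  exact X1.analyticMuLE_zero_and_analyticLambdaEq_add_of_truncCongr hf hϖ hG hU he hQ hd
    (EisensteinPrimesAnalyticLambdaValueCongruence.toZMod_ne_zero_of_isUnit hc) (K := _ + 1)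
    (fun j _ ↦ EisensteinPrimesAnalyticLambdaValueCongruence.forall_coeff_toZMod_eq_of_forall_norm_tsum_le
      hval j) (Nat.lt_succ_self _)

end X1

end Summit.BirchSwinnertonDyer.BirchSwinnertonDyer.Theorems.EisensteinPrimesAnalyticLambdaNonUnitCount

end
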